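import Summits.QuantumFields.BalabanUV.Beta.GAN24.OneStepConstraintLocalisation
import Summits.QuantumFields.BalabanUV.Beta.GAN24.FluctuationCovarianceRateTransfer

/-!
# `BalabanUV.Beta.GAN24.OneStepConstraintRate` — binder row G-an2-4 ∕ (CONV-C), routes C-R6° («VALUES») × R7 («TWO CURRENCIES»), PART 172:
# THE RATE HALF FOR BAŁABAN's ONE-STEP CONSTRAINT `Q = re QB N R M` AT A FIXED LATTICE — `𝒮`, `ℋ`, `𝒢` ARE LIPSCHITZ IN THE FINE FORM, ENTRYWISE WITH DECAY.
# Two fine forms `H, H′` with PART 170's model-side letters (symmetric, `0 ≤ ⟨u,·u⟩ ≤ h|u|²`, `γ₀`-coercive on `ker (re QB)`, entries `≤ h₀e^{−δ_H·tdist(par x, par x′)}`) and the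
# RATE letter `|(H − H′)(x,x′)| ≤ ε·e^{−δ_H·tdist(par x, par x′)}` ⟹ `|(𝒮 − 𝒮′)(b,b′)|`, `|(ℋ′ − ℋ)(x,b)|`, `|(𝒢′ − 𝒢)(x,x′)|` are `≤ (const)·ε·e^{−(rate)·(distance)}` — LINEAR in
# `ε`, constants closed expressions in `(d, R, a, h, γ₀, h₀, δ_H)` and the site profile `Kf`: PARTs 107 ∕ 113 ∕ 114 at `Qf = 1` with the soft one-step letter
# `E = K′⁻¹ − K⁻¹` supplied by PART 107's linear resolvent perturbation on the fine gauge (unit b2b-balaban-gan24-p3, gen 58; v1)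

NOT IN PRINT; OUR PROOF ([folklore] composition BY NAME: PART 107 `EffectiveFormRateTransfer.abs_inv_sub_inv_le` (second resolvent identity with decay) on PART 170's fine gauge, PART 113
`BlockRatesFromSoftResolvent.abs_effForm_sub_le_of_soft ∕ abs_avg_minOp_sub_le_of_soft` and PART 114 `FluctuationCovarianceRateTransfer.abs_avg_flucCov_sub_le_of_soft` at the trivial
finer averaging `Qf = 1`, with every constraint-side letter from PARTs 168–170 (`sum_abs_reM_QB_row`, `ub_QB`, `coercive_reg_QB`, `tdist_le_tdist_par_add_two`, `tdist_par_le_tdist_par_add_one`,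
`abs_regForm_apply_le`, `abs_blockProp_le_QB`, `abs_inv_mul_transpose_le_QB`, the gauges and profiles).  [B9] Thm 3.1 is the printed CLASS of such statements; nothing printed is a hypothesis.)
HONEST FRAMING (cell contract, verbatim): «discharging `BetaPertH` makes Bałaban's UV stability UNCONDITIONAL — a real constructive-QFT result; it is NOT the continuum limit
and NOT the Clay problem.»  HONEST DEPENDENCY (verbatim): «continuum YM on T⁴ ⇐ BetaPertH ∧ nine spine estimates (0/9 proved); BetaPertH ⇐ (D1) ∧ (D4) ∧ CAP+tail; G-an2-4 gates
asym, D1 and NE2/3/4.»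

WHY.  In the one-loop step the constraint `Q̃ = re QB` and its lattice are the SAME at every level `k`; only the fine form changes (`H_k` = the level image of `Σ_k`), and the lineage's INPUT
triple carries, besides the k-uniform decay (UD), the STEP RATE (SR) `|Σ_{k+1} − Σ_k| ≤ B·ρ^k·e^{−δ·dist}`.  PART 170 transfers (UD) to `𝒢_k = flucCov H_k (re QB)`; THIS FILE transfers (SR):
feed `ε = B·ρ^k` and read `|𝒢_{k+1} − 𝒢_k| ≤ (const)·B·ρ^k·e^{−(rate)·D}`.  (The two-level `Qf` of PARTs 113 ∕ 114 is the trivial `1` here: no finer constraint appears in one step.)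

THE GAUGES AND CONSTANTS: as PART 170 (`ρ`, `D`, `σ`; `γ_K`, `c_K`, `r_F`, `Λ = h·R^{2d}`), plus `r = r_F∕2` (every decay input is read at the WEAKER rate `r`, as PART 113 requires the soft letter's
rate to dominate), `c₀ = (2∕γ_K)e^{2r_F}`, `c₁ = (2∕γ_K)e^{r_F}`, the soft one-step amplitude `ε_E = (2∕γ_K)²·ε·(d·R^d·Kf(r_F∕2))²`, `r_U′ = rate (s ↦ d·Kf s) (Λ+a)⁻¹ c₀ r`.
WHAT THIS FILE PROVES (0 sorry, 0 `def`; `N, R ≥ 1`, every torus `M`, every `d`):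
* §1 **`abs_inv_sub_inv_regForm_le`** — THE SOFT ONE-STEP LETTER `E`: `|(K′⁻¹ − K⁻¹)(x,x′)| ≤ ε_E·e^{−r·tdist(par x, par x′)}` (`K = H + (re QB)ᵀ(a•1)(re QB)`, `K′` likewise; the regulariser
  cancels in `K − K′ = H − H′`); `abs_blockProp_le_QB_half`, `abs_inv_mul_transpose_le_QB_half` (PART 170's two unit letters read at rate `r`).
* §2 **`abs_effForm_sub_le_QB`** (`|(𝒮 − 𝒮′)(b,b′)| ≤ 4(Λ+a)²·(1²·ε_E·e^{2r})·(d·Kf(r_U′∕2))²·e^{−(r_U′∕2)·tdist(b,b′)}`), **`abs_minOp_sub_le_QB`** (`|(ℋ′ − ℋ)(x,b)| ≤ …·e^{−(m′∕2)·σ}`,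
  `m′ = min r (r_U′∕2)`), **`abs_flucCov_sub_le_QB`** (`|(𝒢′ − 𝒢)(x,x′)| ≤ (ε_E + …)·e^{−(m′∕4)·D}`) — the constants are PART 113 ∕ 114's, printed with `q₁ = 1`, `R = 2`, `R′ = 1`, `Kσ = d·Kf`;
  every term carries a factor `ε`.
WHAT IT IS NOT: as PART 170 — no model-side letter (in particular the (SR) input `ε = B·ρ^k` for `H_k` is the adapter's, from PART 142-type files read on the block lattice); ONE lattice; the
EL₂ (volume-limit) third of the INPUT triple is untouched (PART 144 ∕ 156-type).  SUPPLIER work; no consumer of record yet; NEVER «G-an2-4 closed»; NOT (CONV-C), NOT D1, NOT `BetaPertH`,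
NOT continuum, NOT Clay.  Records: `HOME/b2b-balaban-gan24-p3/gen58/README.md`.
-/

noncomputable section

open scoped BigOperators Matrix
open Finset Matrix

namespace Summit.QuantumFields.BalabanUV.Beta.GAN24.OneStepConstraintRate

open Literature.MathematicalPhysics.QuantumFieldTheory.Balaban1983to89
open Literature.MathematicalPhysics.QuantumFieldTheory.Balaban1983to89.B4Sect5Torus (IsPseudoDist SumBound rate rate_pos)
open Literature.MathematicalPhysics.QuantumFieldTheory.Balaban1983to89.Beta.Composition (blockProp)
open Literature.MathematicalPhysics.QuantumFieldTheory.Balaban1983to89.Beta.CompositionSingular (effForm minOp flucCov)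
open Literature.MathematicalPhysics.QuantumFieldTheory.Balaban1983to89.B5Prop11Plancherel (Tor fine)
open Literature.MathematicalPhysics.QuantumFieldTheory.Balaban1983to89.B5RealFields (reM)
open Literature.MathematicalPhysics.QuantumFieldTheory.Balaban1983to89.Beta.VectorTailsCov (tdist tdist_triangle tdist_comm)
open Summit.QuantumFields.BalabanUV.T4Continuum.BalabanLineAverage (QB)
open Summit.QuantumFields.BalabanUV.T4Continuum.BalabanAveragedTowerModes (par)
open Summit.QuantumFields.BalabanUV.Beta.GAN24.EffectiveFormLocalisation (transpose_reg)
open Summit.QuantumFields.BalabanUV.Beta.GAN24.EffectiveFormRateTransfer (abs_inv_sub_inv_le)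
open Summit.QuantumFields.BalabanUV.Beta.GAN24.BlockRatesFromSoftResolvent (abs_effForm_sub_le_of_soft abs_avg_minOp_sub_le_of_soft)
open Summit.QuantumFields.BalabanUV.Beta.GAN24.FluctuationCovarianceRateTransfer (abs_avg_flucCov_sub_le_of_soft)
open Summit.QuantumFields.BalabanUV.Beta.GAN24.OneStepConstraintLetters (sum_abs_reM_QB_row ub_QB)
open Summit.QuantumFields.BalabanUV.Beta.GAN24.OneStepConstraintLettersReg (coercive_reg_QB tdist_le_tdist_par_add_two tdist_par_le_tdist_par_add_one)
open Summit.QuantumFields.BalabanUV.Beta.GAN24.OneStepConstraintLocalisation (isPseudoDist_coarse isPseudoDist_fine sumBound_coarse sumBound_fine sum_exp_sigma_le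
  abs_regForm_apply_le gammaK_pos abs_blockProp_le_QB abs_inv_mul_transpose_le_QB)

variable {d : ℕ} (N R : ℕ) [NeZero N] [NeZero R] (M : Fin d → ℕ) [hM : ∀ μ, NeZero (M μ)]

variable {H H' : Matrix (Tor (fine (R * N) M) × Fin d) (Tor (fine (R * N) M) × Fin d) ℝ} {Kf : ℝ → ℝ}

/-! ## §1 The soft one-step letter `E = K′⁻¹ − K⁻¹` and the two unit letters at the half rate -/

section Soft

/-- **`abs_inv_sub_inv_regForm_le` — THE SOFT ONE-STEP LETTER FOR BAŁABAN's ONE-STEP CONSTRAINT** [our proof; PART 107 `abs_inv_sub_inv_le` on the fine gauge with PART 169's coercivity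
and PART 170's entry bound, the regulariser cancelling in `K − K′`]: `|(K′⁻¹ − K⁻¹)(x,x′)| ≤ (2∕γ_K)²·ε·(d·R^d·Kf(r_F∕2))²·e^{−(r_F∕2)·tdist(par x, par x′)}`. -/
theorem abs_inv_sub_inv_regForm_le (hKf0 : ∀ s : ℝ, 0 < s → 0 ≤ Kf s)
    (hKf : ∀ s : ℝ, 0 < s → ∀ y : Tor (fine N M), ∑ y' : Tor (fine N M), Real.exp (-(s * (tdist y y' : ℝ))) ≤ Kf s)
    (hH : Hᵀ = H) (hpsd : ∀ z, 0 ≤ z ⬝ᵥ (H *ᵥ z)) (hH' : H'ᵀ = H') (hpsd' : ∀ z, 0 ≤ z ⬝ᵥ (H' *ᵥ z)) {h : ℝ} (hh : 0 ≤ h)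
    (hHub : ∀ u, u ⬝ᵥ (H *ᵥ u) ≤ h * (u ⬝ᵥ u)) (hHub' : ∀ u, u ⬝ᵥ (H' *ᵥ u) ≤ h * (u ⬝ᵥ u)) {γ₀ : ℝ} (hγ₀ : 0 < γ₀)
    (hker : ∀ z, reM (QB N R M) *ᵥ z = 0 → γ₀ * (z ⬝ᵥ z) ≤ z ⬝ᵥ (H *ᵥ z)) (hker' : ∀ z, reM (QB N R M) *ᵥ z = 0 → γ₀ * (z ⬝ᵥ z) ≤ z ⬝ᵥ (H' *ᵥ z))
    {a h₀ δH : ℝ} (ha : 0 < a) (hh₀ : 0 ≤ h₀) (hδH : 0 < δH)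
    (hHent : ∀ x x', |H x x'| ≤ h₀ * Real.exp (-(δH * (tdist (par N R M x.1) (par N R M x'.1) : ℝ))))
    (hHent' : ∀ x x', |H' x x'| ≤ h₀ * Real.exp (-(δH * (tdist (par N R M x.1) (par N R M x'.1) : ℝ)))) {ε : ℝ} (hε : 0 ≤ ε)
    (hdiff : ∀ x x', |(H - H') x x'| ≤ ε * Real.exp (-(δH * (tdist (par N R M x.1) (par N R M x'.1) : ℝ))))
    {γK cK rF : ℝ} (hγK : γK = (max (4 / γ₀) ((4 * h * ((R : ℝ) ^ d) ^ 2 / γ₀ + 2 * ((R : ℝ) ^ d) ^ 2) / a))⁻¹)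
    (hcK : cK = h₀ + a * (((R : ℝ) ^ d)⁻¹ * ((R : ℝ) ^ d)⁻¹) * Real.exp (2 * δH)) (hrF : rF = rate (fun s => (d : ℝ) * (R : ℝ) ^ d * Kf s) γK cK δH)
    (x x' : Tor (fine (R * N) M) × Fin d) :
    |((H' + (reM (QB N R M))ᵀ * (a • (1 : Matrix (Tor (fine N M) × Fin d) (Tor (fine N M) × Fin d) ℝ)) * reM (QB N R M))⁻¹ -
        (H + (reM (QB N R M))ᵀ * (a • (1 : Matrix (Tor (fine N M) × Fin d) (Tor (fine N M) × Fin d) ℝ)) * reM (QB N R M))⁻¹) x x'| ≤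
      (2 / γK) ^ 2 * ε * ((d : ℝ) * (R : ℝ) ^ d * Kf (rF / 2)) ^ 2 * Real.exp (-(rF / 2 * (tdist (par N R M x.1) (par N R M x'.1) : ℝ))) := by
  have hγpos : 0 < γK := by rw [hγK]; exact gammaK_pos R hγ₀
  have hcK0 : 0 ≤ cK := by rw [hcK]; positivity
  have hprof : ∀ s : ℝ, 0 < s → 0 ≤ (d : ℝ) * (R : ℝ) ^ d * Kf s := fun s hs => by have := hKf0 s hs; positivity
  have hK := coercive_reg_QB N R M hH hpsd hh hHub hγ₀ hker ha
  have hK' := coercive_reg_QB N R M hH' hpsd' hh hHub' hγ₀ hker' ha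
  rw [← hγK] at hK hK'
  have hA : ∀ p q, |(H + (reM (QB N R M))ᵀ * (a • (1 : Matrix (Tor (fine N M) × Fin d) (Tor (fine N M) × Fin d) ℝ)) * reM (QB N R M)) p q| ≤
      cK * Real.exp (-(δH * (tdist (par N R M p.1) (par N R M q.1) : ℝ))) := fun p q => by
    rw [hcK]; exact abs_regForm_apply_le N R M ha.le hδH.le hHent p q
  have hA' : ∀ p q, |(H' + (reM (QB N R M))ᵀ * (a • (1 : Matrix (Tor (fine N M) × Fin d) (Tor (fine N M) × Fin d) ℝ)) * reM (QB N R M)) p q| ≤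
      cK * Real.exp (-(δH * (tdist (par N R M p.1) (par N R M q.1) : ℝ))) := fun p q => by
    rw [hcK]; exact abs_regForm_apply_le N R M ha.le hδH.le hHent' p q
  have hd : ∀ p q, |((H + (reM (QB N R M))ᵀ * (a • (1 : Matrix (Tor (fine N M) × Fin d) (Tor (fine N M) × Fin d) ℝ)) * reM (QB N R M)) -
      (H' + (reM (QB N R M))ᵀ * (a • (1 : Matrix (Tor (fine N M) × Fin d) (Tor (fine N M) × Fin d) ℝ)) * reM (QB N R M))) p q| ≤
      ε * Real.exp (-(δH * (tdist (par N R M p.1) (par N R M q.1) : ℝ))) := fun p q => by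
    rw [add_sub_add_right_eq_sub]; exact hdiff p q
  have hmain := abs_inv_sub_inv_le hprof (isPseudoDist_fine N R M) (sumBound_fine N R M hKf) (transpose_reg hH a) (transpose_reg hH' a)
    hγpos hcK0 hδH hε hK hK' hA hA' hd x x'
  rw [← hrF, Matrix.sub_apply] at hmain
  rwa [Matrix.sub_apply, abs_sub_comm]

/-- PART 170's block-propagator letter read at the half rate `r_F∕2`. [folklore] -/
theorem abs_blockProp_le_QB_half (hKf0 : ∀ s : ℝ, 0 < s → 0 ≤ Kf s)
    (hKf : ∀ s : ℝ, 0 < s → ∀ y : Tor (fine N M), ∑ y' : Tor (fine N M), Real.exp (-(s * (tdist y y' : ℝ))) ≤ Kf s)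
    (hH : Hᵀ = H) (hpsd : ∀ z, 0 ≤ z ⬝ᵥ (H *ᵥ z)) {h : ℝ} (hh : 0 ≤ h) (hHub : ∀ u, u ⬝ᵥ (H *ᵥ u) ≤ h * (u ⬝ᵥ u)) {γ₀ : ℝ} (hγ₀ : 0 < γ₀)
    (hker : ∀ z, reM (QB N R M) *ᵥ z = 0 → γ₀ * (z ⬝ᵥ z) ≤ z ⬝ᵥ (H *ᵥ z)) {a h₀ δH : ℝ} (ha : 0 < a) (hh₀ : 0 ≤ h₀) (hδH : 0 < δH)
    (hHent : ∀ x x', |H x x'| ≤ h₀ * Real.exp (-(δH * (tdist (par N R M x.1) (par N R M x'.1) : ℝ))))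
    {γK cK rF c₀ : ℝ} (hγK : γK = (max (4 / γ₀) ((4 * h * ((R : ℝ) ^ d) ^ 2 / γ₀ + 2 * ((R : ℝ) ^ d) ^ 2) / a))⁻¹)
    (hcK : cK = h₀ + a * (((R : ℝ) ^ d)⁻¹ * ((R : ℝ) ^ d)⁻¹) * Real.exp (2 * δH)) (hrF : rF = rate (fun s => (d : ℝ) * (R : ℝ) ^ d * Kf s) γK cK δH)
    (hc₀ : c₀ = 2 / γK * Real.exp (2 * rF)) (b b' : Tor (fine N M) × Fin d) :
    |blockProp (H + (reM (QB N R M))ᵀ * (a • (1 : Matrix (Tor (fine N M) × Fin d) (Tor (fine N M) × Fin d) ℝ)) * reM (QB N R M)) (reM (QB N R M)) b b'| ≤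
      c₀ * Real.exp (-(rF / 2 * (tdist b.1 b'.1 : ℝ))) := by
  have hγpos : 0 < γK := by rw [hγK]; exact gammaK_pos R hγ₀
  have hcK0 : 0 ≤ cK := by rw [hcK]; positivity
  have hprof : ∀ s : ℝ, 0 < s → 0 ≤ (d : ℝ) * (R : ℝ) ^ d * Kf s := fun s hs => by have := hKf0 s hs; positivity
  have hrF0 : 0 < rF := by rw [hrF]; exact rate_pos hprof hγpos hcK0 hδH
  have hc₀0 : 0 ≤ c₀ := by rw [hc₀]; positivity
  refine (abs_blockProp_le_QB N R M hKf0 hKf hH hpsd hh hHub hγ₀ hker ha hh₀ hδH hHent hγK hcK hrF hc₀ b b').trans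
    (mul_le_mul_of_nonneg_left (Real.exp_le_exp.mpr ?_) hc₀0)
  have h0 : (0 : ℝ) ≤ (tdist b.1 b'.1 : ℝ) := Nat.cast_nonneg _
  nlinarith

/-- PART 170's soft-column letter read at the half rate `r_F∕2`. [folklore] -/
theorem abs_inv_mul_transpose_le_QB_half (hKf0 : ∀ s : ℝ, 0 < s → 0 ≤ Kf s)
    (hKf : ∀ s : ℝ, 0 < s → ∀ y : Tor (fine N M), ∑ y' : Tor (fine N M), Real.exp (-(s * (tdist y y' : ℝ))) ≤ Kf s)
    (hH : Hᵀ = H) (hpsd : ∀ z, 0 ≤ z ⬝ᵥ (H *ᵥ z)) {h : ℝ} (hh : 0 ≤ h) (hHub : ∀ u, u ⬝ᵥ (H *ᵥ u) ≤ h * (u ⬝ᵥ u)) {γ₀ : ℝ} (hγ₀ : 0 < γ₀)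
    (hker : ∀ z, reM (QB N R M) *ᵥ z = 0 → γ₀ * (z ⬝ᵥ z) ≤ z ⬝ᵥ (H *ᵥ z)) {a h₀ δH : ℝ} (ha : 0 < a) (hh₀ : 0 ≤ h₀) (hδH : 0 < δH)
    (hHent : ∀ x x', |H x x'| ≤ h₀ * Real.exp (-(δH * (tdist (par N R M x.1) (par N R M x'.1) : ℝ))))
    {γK cK rF c₁ : ℝ} (hγK : γK = (max (4 / γ₀) ((4 * h * ((R : ℝ) ^ d) ^ 2 / γ₀ + 2 * ((R : ℝ) ^ d) ^ 2) / a))⁻¹)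
    (hcK : cK = h₀ + a * (((R : ℝ) ^ d)⁻¹ * ((R : ℝ) ^ d)⁻¹) * Real.exp (2 * δH)) (hrF : rF = rate (fun s => (d : ℝ) * (R : ℝ) ^ d * Kf s) γK cK δH)
    (hc₁ : c₁ = 2 / γK * Real.exp rF) (x : Tor (fine (R * N) M) × Fin d) (b : Tor (fine N M) × Fin d) :
    |((H + (reM (QB N R M))ᵀ * (a • (1 : Matrix (Tor (fine N M) × Fin d) (Tor (fine N M) × Fin d) ℝ)) * reM (QB N R M))⁻¹ * (reM (QB N R M))ᵀ) x b| ≤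
      c₁ * Real.exp (-(rF / 2 * (tdist (par N R M x.1) b.1 : ℝ))) := by
  have hγpos : 0 < γK := by rw [hγK]; exact gammaK_pos R hγ₀
  have hcK0 : 0 ≤ cK := by rw [hcK]; positivity
  have hprof : ∀ s : ℝ, 0 < s → 0 ≤ (d : ℝ) * (R : ℝ) ^ d * Kf s := fun s hs => by have := hKf0 s hs; positivity
  have hrF0 : 0 < rF := by rw [hrF]; exact rate_pos hprof hγpos hcK0 hδH
  have hc₁0 : 0 ≤ c₁ := by rw [hc₁]; positivity
  refine (abs_inv_mul_transpose_le_QB N R M hKf0 hKf hH hpsd hh hHub hγ₀ hker ha hh₀ hδH hHent hγK hcK hrF hc₁ x b).trans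
    (mul_le_mul_of_nonneg_left (Real.exp_le_exp.mpr ?_) hc₁0)
  have h0 : (0 : ℝ) ≤ (tdist (par N R M x.1) b.1 : ℝ) := Nat.cast_nonneg _
  nlinarith

end Soft

/-! ## §2 The three RATE ENDs (PARTs 113 ∕ 114 at `Qf = 1`) -/

section Ends

/-- **`abs_effForm_sub_le_QB` — THE EFFECTIVE FORM OF BAŁABAN's ONE-STEP CONSTRAINT IS LIPSCHITZ IN THE FINE FORM, ENTRYWISE WITH DECAY** [our proof; PART 113 `abs_effForm_sub_le_of_soft` at
`Qf = 1` with §1's soft one-step letter and PARTs 168–170's constraint letters]: `|(𝒮 − 𝒮′)(b,b′)| ≤ 4(Λ+a)²·(1²·ε_E·e^{r·2})·(d·Kf(r_U′∕2))²·e^{−(r_U′∕2)·tdist(b,b′)}`. -/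
theorem abs_effForm_sub_le_QB (hKf0 : ∀ s : ℝ, 0 < s → 0 ≤ Kf s)
    (hKf : ∀ s : ℝ, 0 < s → ∀ y : Tor (fine N M), ∑ y' : Tor (fine N M), Real.exp (-(s * (tdist y y' : ℝ))) ≤ Kf s)
    (hH : Hᵀ = H) (hpsd : ∀ z, 0 ≤ z ⬝ᵥ (H *ᵥ z)) (hH' : H'ᵀ = H') (hpsd' : ∀ z, 0 ≤ z ⬝ᵥ (H' *ᵥ z)) {h : ℝ} (hh : 0 ≤ h)
    (hHub : ∀ u, u ⬝ᵥ (H *ᵥ u) ≤ h * (u ⬝ᵥ u)) (hHub' : ∀ u, u ⬝ᵥ (H' *ᵥ u) ≤ h * (u ⬝ᵥ u)) {γ₀ : ℝ} (hγ₀ : 0 < γ₀)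
    (hker : ∀ z, reM (QB N R M) *ᵥ z = 0 → γ₀ * (z ⬝ᵥ z) ≤ z ⬝ᵥ (H *ᵥ z)) (hker' : ∀ z, reM (QB N R M) *ᵥ z = 0 → γ₀ * (z ⬝ᵥ z) ≤ z ⬝ᵥ (H' *ᵥ z))
    {a h₀ δH : ℝ} (ha : 0 < a) (hh₀ : 0 ≤ h₀) (hδH : 0 < δH)
    (hHent : ∀ x x', |H x x'| ≤ h₀ * Real.exp (-(δH * (tdist (par N R M x.1) (par N R M x'.1) : ℝ))))
    (hHent' : ∀ x x', |H' x x'| ≤ h₀ * Real.exp (-(δH * (tdist (par N R M x.1) (par N R M x'.1) : ℝ)))) {ε : ℝ} (hε : 0 ≤ ε)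
    (hdiff : ∀ x x', |(H - H') x x'| ≤ ε * Real.exp (-(δH * (tdist (par N R M x.1) (par N R M x'.1) : ℝ))))
    {γK cK rF r c₀ Λ εE rU' : ℝ} (hγK : γK = (max (4 / γ₀) ((4 * h * ((R : ℝ) ^ d) ^ 2 / γ₀ + 2 * ((R : ℝ) ^ d) ^ 2) / a))⁻¹)
    (hcK : cK = h₀ + a * (((R : ℝ) ^ d)⁻¹ * ((R : ℝ) ^ d)⁻¹) * Real.exp (2 * δH)) (hrF : rF = rate (fun s => (d : ℝ) * (R : ℝ) ^ d * Kf s) γK cK δH)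
    (hr : r = rF / 2) (hc₀ : c₀ = 2 / γK * Real.exp (2 * rF)) (hΛ : Λ = h * ((R : ℝ) ^ d) ^ 2)
    (hεE : εE = (2 / γK) ^ 2 * ε * ((d : ℝ) * (R : ℝ) ^ d * Kf (rF / 2)) ^ 2) (hrU' : rU' = rate (fun s => (d : ℝ) * Kf s) (Λ + a)⁻¹ c₀ r)
    (b b' : Tor (fine N M) × Fin d) :
    |(effForm H (reM (QB N R M)) - effForm H' (reM (QB N R M))) b b'| ≤
      4 * (Λ + a) ^ 2 * ((1 : ℝ) ^ 2 * εE * Real.exp (r * 2)) * ((d : ℝ) * Kf (rU' / 2)) ^ 2 * Real.exp (-(rU' / 2 * (tdist b.1 b'.1 : ℝ))) := by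
  have hγpos : 0 < γK := by rw [hγK]; exact gammaK_pos R hγ₀
  have hcK0 : 0 ≤ cK := by rw [hcK]; positivity
  have hprofF : ∀ s : ℝ, 0 < s → 0 ≤ (d : ℝ) * (R : ℝ) ^ d * Kf s := fun s hs => by have := hKf0 s hs; positivity
  have hprofU : ∀ s : ℝ, 0 < s → 0 ≤ (d : ℝ) * Kf s := fun s hs => by have := hKf0 s hs; positivity
  have hrF0 : 0 < rF := by rw [hrF]; exact rate_pos hprofF hγpos hcK0 hδH
  have hr0 : 0 < r := by rw [hr]; positivity
  have hc₀0 : 0 ≤ c₀ := by rw [hc₀]; positivity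
  have hΛ0 : 0 ≤ Λ := by rw [hΛ]; positivity
  have hεE0 : 0 ≤ εE := by rw [hεE]; have := hKf0 (rF / 2) (by positivity); positivity
  have hK := coercive_reg_QB N R M hH hpsd hh hHub hγ₀ hker ha
  have hK' := coercive_reg_QB N R M hH' hpsd' hh hHub' hγ₀ hker' ha
  rw [← hγK] at hK hK'
  have hUB := ub_QB N R M (H := H) hHub
  have hUB' := ub_QB N R M (H := H') hHub'
  simp_rw [← hΛ] at hUB hUB'
  have hP := abs_blockProp_le_QB_half N R M hKf0 hKf hH hpsd hh hHub hγ₀ hker ha hh₀ hδH hHent hγK hcK hrF hc₀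
  have hP' := abs_blockProp_le_QB_half N R M hKf0 hKf hH' hpsd' hh hHub' hγ₀ hker' ha hh₀ hδH hHent' hγK hcK hrF hc₀
  simp_rw [← hr] at hP hP'
  have hE := abs_inv_sub_inv_regForm_le N R M hKf0 hKf hH hpsd hH' hpsd' hh hHub hHub' hγ₀ hker hker' ha hh₀ hδH hHent hHent' hε hdiff hγK hcK hrF
  simp_rw [← hεE, ← hr] at hE
  have h := abs_effForm_sub_le_of_soft (Qf := (1 : Matrix (Tor (fine (R * N) M) × Fin d) (Tor (fine (R * N) M) × Fin d) ℝ))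
    (ρ := fun b b' : Tor (fine N M) × Fin d => (tdist b.1 b'.1 : ℝ))
    (D := fun x x' : Tor (fine (R * N) M) × Fin d => (tdist (par N R M x.1) (par N R M x'.1) : ℝ))
    hprofU (isPseudoDist_coarse N M) (sumBound_coarse N M hKf) ha hγpos hΛ0 hc₀0 hr0 hεE0 le_rfl hH hpsd hK hUB hP hH' hpsd'
    (by simpa only [Matrix.mul_one] using hK') (by simpa only [Matrix.mul_one] using hUB') (by simpa only [Matrix.mul_one] using hP')
    (by simpa only [Matrix.mul_one, Matrix.one_mul, Matrix.transpose_one] using hE)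
    (fun b => (sum_abs_reM_QB_row N R M b).le) (fun b x b' x' hb hb' => tdist_le_tdist_par_add_two N R M hb hb') b b'
  rw [← hrU'] at h
  simpa only [Matrix.mul_one] using h

/-- **`abs_minOp_sub_le_QB` — THE HARD MINIMISER OF BAŁABAN's ONE-STEP CONSTRAINT IS LIPSCHITZ IN THE FINE FORM, COLUMNWISE WITH DECAY** [our proof; PART 113
`abs_avg_minOp_sub_le_of_soft` at `Qf = 1`]: `|(ℋ′ − ℋ)(x,b)| ≤ (2(Λ+a)·(1·ε_E·e^{r·1}) + 4(Λ+a)²·(d·Kf(r_U′∕2))²·c₁·(1²·ε_E·e^{r·2}))·(d·Kf(m′∕2))·e^{−(m′∕2)·tdist(par x, b)}`,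
`m′ = min r (r_U′∕2)`. -/
theorem abs_minOp_sub_le_QB (hKf0 : ∀ s : ℝ, 0 < s → 0 ≤ Kf s)
    (hKf : ∀ s : ℝ, 0 < s → ∀ y : Tor (fine N M), ∑ y' : Tor (fine N M), Real.exp (-(s * (tdist y y' : ℝ))) ≤ Kf s)
    (hH : Hᵀ = H) (hpsd : ∀ z, 0 ≤ z ⬝ᵥ (H *ᵥ z)) (hH' : H'ᵀ = H') (hpsd' : ∀ z, 0 ≤ z ⬝ᵥ (H' *ᵥ z)) {h : ℝ} (hh : 0 ≤ h)
    (hHub : ∀ u, u ⬝ᵥ (H *ᵥ u) ≤ h * (u ⬝ᵥ u)) (hHub' : ∀ u, u ⬝ᵥ (H' *ᵥ u) ≤ h * (u ⬝ᵥ u)) {γ₀ : ℝ} (hγ₀ : 0 < γ₀)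
    (hker : ∀ z, reM (QB N R M) *ᵥ z = 0 → γ₀ * (z ⬝ᵥ z) ≤ z ⬝ᵥ (H *ᵥ z)) (hker' : ∀ z, reM (QB N R M) *ᵥ z = 0 → γ₀ * (z ⬝ᵥ z) ≤ z ⬝ᵥ (H' *ᵥ z))
    {a h₀ δH : ℝ} (ha : 0 < a) (hh₀ : 0 ≤ h₀) (hδH : 0 < δH)
    (hHent : ∀ x x', |H x x'| ≤ h₀ * Real.exp (-(δH * (tdist (par N R M x.1) (par N R M x'.1) : ℝ))))
    (hHent' : ∀ x x', |H' x x'| ≤ h₀ * Real.exp (-(δH * (tdist (par N R M x.1) (par N R M x'.1) : ℝ)))) {ε : ℝ} (hε : 0 ≤ ε)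
    (hdiff : ∀ x x', |(H - H') x x'| ≤ ε * Real.exp (-(δH * (tdist (par N R M x.1) (par N R M x'.1) : ℝ))))
    {γK cK rF r c₀ c₁ Λ εE rU' : ℝ} (hγK : γK = (max (4 / γ₀) ((4 * h * ((R : ℝ) ^ d) ^ 2 / γ₀ + 2 * ((R : ℝ) ^ d) ^ 2) / a))⁻¹)
    (hcK : cK = h₀ + a * (((R : ℝ) ^ d)⁻¹ * ((R : ℝ) ^ d)⁻¹) * Real.exp (2 * δH)) (hrF : rF = rate (fun s => (d : ℝ) * (R : ℝ) ^ d * Kf s) γK cK δH)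
    (hr : r = rF / 2) (hc₀ : c₀ = 2 / γK * Real.exp (2 * rF)) (hc₁ : c₁ = 2 / γK * Real.exp rF) (hΛ : Λ = h * ((R : ℝ) ^ d) ^ 2)
    (hεE : εE = (2 / γK) ^ 2 * ε * ((d : ℝ) * (R : ℝ) ^ d * Kf (rF / 2)) ^ 2) (hrU' : rU' = rate (fun s => (d : ℝ) * Kf s) (Λ + a)⁻¹ c₀ r)
    (x : Tor (fine (R * N) M) × Fin d) (b : Tor (fine N M) × Fin d) :
    |(minOp H' (reM (QB N R M)) - minOp H (reM (QB N R M))) x b| ≤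
      (2 * (Λ + a) * ((1 : ℝ) * εE * Real.exp (r * 1)) + 4 * (Λ + a) ^ 2 * ((d : ℝ) * Kf (rU' / 2)) ^ 2 * c₁ * ((1 : ℝ) ^ 2 * εE * Real.exp (r * 2))) *
        ((d : ℝ) * Kf (min r (rU' / 2) / 2)) * Real.exp (-(min r (rU' / 2) / 2 * (tdist (par N R M x.1) b.1 : ℝ))) := by
  have hγpos : 0 < γK := by rw [hγK]; exact gammaK_pos R hγ₀
  have hcK0 : 0 ≤ cK := by rw [hcK]; positivity
  have hprofF : ∀ s : ℝ, 0 < s → 0 ≤ (d : ℝ) * (R : ℝ) ^ d * Kf s := fun s hs => by have := hKf0 s hs; positivity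
  have hprofU : ∀ s : ℝ, 0 < s → 0 ≤ (d : ℝ) * Kf s := fun s hs => by have := hKf0 s hs; positivity
  have hrF0 : 0 < rF := by rw [hrF]; exact rate_pos hprofF hγpos hcK0 hδH
  have hr0 : 0 < r := by rw [hr]; positivity
  have hc₀0 : 0 ≤ c₀ := by rw [hc₀]; positivity
  have hc₁0 : 0 ≤ c₁ := by rw [hc₁]; positivity
  have hΛ0 : 0 ≤ Λ := by rw [hΛ]; positivity
  have hεE0 : 0 ≤ εE := by rw [hεE]; have := hKf0 (rF / 2) (by positivity); positivity
  have hK := coercive_reg_QB N R M hH hpsd hh hHub hγ₀ hker ha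
  have hK' := coercive_reg_QB N R M hH' hpsd' hh hHub' hγ₀ hker' ha
  rw [← hγK] at hK hK'
  have hUB := ub_QB N R M (H := H) hHub
  have hUB' := ub_QB N R M (H := H') hHub'
  simp_rw [← hΛ] at hUB hUB'
  have hP := abs_blockProp_le_QB_half N R M hKf0 hKf hH hpsd hh hHub hγ₀ hker ha hh₀ hδH hHent hγK hcK hrF hc₀
  have hP' := abs_blockProp_le_QB_half N R M hKf0 hKf hH' hpsd' hh hHub' hγ₀ hker' ha hh₀ hδH hHent' hγK hcK hrF hc₀
  have hT := abs_inv_mul_transpose_le_QB_half N R M hKf0 hKf hH hpsd hh hHub hγ₀ hker ha hh₀ hδH hHent hγK hcK hrF hc₁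
  simp_rw [← hr] at hP hP' hT
  have hE := abs_inv_sub_inv_regForm_le N R M hKf0 hKf hH hpsd hH' hpsd' hh hHub hHub' hγ₀ hker hker' ha hh₀ hδH hHent hHent' hε hdiff hγK hcK hrF
  simp_rw [← hεE, ← hr] at hE
  have h := abs_avg_minOp_sub_le_of_soft (Qf := (1 : Matrix (Tor (fine (R * N) M) × Fin d) (Tor (fine (R * N) M) × Fin d) ℝ))
    (ρ := fun b b' : Tor (fine N M) × Fin d => (tdist b.1 b'.1 : ℝ))
    (D := fun x x' : Tor (fine (R * N) M) × Fin d => (tdist (par N R M x.1) (par N R M x'.1) : ℝ))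
    (σ := fun (x : Tor (fine (R * N) M) × Fin d) (b : Tor (fine N M) × Fin d) => (tdist (par N R M x.1) b.1 : ℝ))
    hprofU (isPseudoDist_coarse N M) (sumBound_coarse N M hKf) ha hγpos hΛ0 hc₀0 hr0 hεE0 le_rfl hc₁0 hr0 le_rfl hH hpsd hK hUB hP hH' hpsd'
    (by simpa only [Matrix.mul_one] using hK') (by simpa only [Matrix.mul_one] using hUB') (by simpa only [Matrix.mul_one] using hP')
    (by simpa only [Matrix.mul_one, Matrix.one_mul, Matrix.transpose_one] using hE)
    (fun b => (sum_abs_reM_QB_row N R M b).le) (fun b x b' x' hb hb' => tdist_le_tdist_par_add_two N R M hb hb')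
    (fun b x x' hb' => tdist_par_le_tdist_par_add_one N R M x hb')
    (fun x b => Nat.cast_nonneg _) (fun x b b' => by exact_mod_cast tdist_triangle (par N R M x.1) b'.1 b.1) hT x b
  rw [← hrU'] at h
  simpa only [Matrix.mul_one, Matrix.one_mul] using h

/-- **`abs_flucCov_sub_le_QB` — THE FLUCTUATION COVARIANCE OF BAŁABAN's ONE-STEP CONSTRAINT IS LIPSCHITZ IN THE FINE FORM, ENTRYWISE WITH BLOCK DECAY** [our proof; PART 114
`abs_avg_flucCov_sub_le_of_soft` at `Qf = 1`]: `|(𝒢′ − 𝒢)(x,x′)| ≤ (ε_E + (A₁·(c₁ + ε₁) + A₂·ε₁)·(d·Kf(m′∕4)))·e^{−(m′∕4)·tdist(par x, par x′)}` with PART 114's `A₁, A₂, ε₁ = 1·ε_E·e^{r·1}`,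
`m′ = min r (r_U′∕2)` — every term carries a factor `ε`. -/
theorem abs_flucCov_sub_le_QB (hKf0 : ∀ s : ℝ, 0 < s → 0 ≤ Kf s)
    (hKf : ∀ s : ℝ, 0 < s → ∀ y : Tor (fine N M), ∑ y' : Tor (fine N M), Real.exp (-(s * (tdist y y' : ℝ))) ≤ Kf s)
    (hH : Hᵀ = H) (hpsd : ∀ z, 0 ≤ z ⬝ᵥ (H *ᵥ z)) (hH' : H'ᵀ = H') (hpsd' : ∀ z, 0 ≤ z ⬝ᵥ (H' *ᵥ z)) {h : ℝ} (hh : 0 ≤ h)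
    (hHub : ∀ u, u ⬝ᵥ (H *ᵥ u) ≤ h * (u ⬝ᵥ u)) (hHub' : ∀ u, u ⬝ᵥ (H' *ᵥ u) ≤ h * (u ⬝ᵥ u)) {γ₀ : ℝ} (hγ₀ : 0 < γ₀)
    (hker : ∀ z, reM (QB N R M) *ᵥ z = 0 → γ₀ * (z ⬝ᵥ z) ≤ z ⬝ᵥ (H *ᵥ z)) (hker' : ∀ z, reM (QB N R M) *ᵥ z = 0 → γ₀ * (z ⬝ᵥ z) ≤ z ⬝ᵥ (H' *ᵥ z))
    {a h₀ δH : ℝ} (ha : 0 < a) (hh₀ : 0 ≤ h₀) (hδH : 0 < δH)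
    (hHent : ∀ x x', |H x x'| ≤ h₀ * Real.exp (-(δH * (tdist (par N R M x.1) (par N R M x'.1) : ℝ))))
    (hHent' : ∀ x x', |H' x x'| ≤ h₀ * Real.exp (-(δH * (tdist (par N R M x.1) (par N R M x'.1) : ℝ)))) {ε : ℝ} (hε : 0 ≤ ε)
    (hdiff : ∀ x x', |(H - H') x x'| ≤ ε * Real.exp (-(δH * (tdist (par N R M x.1) (par N R M x'.1) : ℝ))))
    {γK cK rF r c₀ c₁ Λ εE rU' : ℝ} (hγK : γK = (max (4 / γ₀) ((4 * h * ((R : ℝ) ^ d) ^ 2 / γ₀ + 2 * ((R : ℝ) ^ d) ^ 2) / a))⁻¹)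
    (hcK : cK = h₀ + a * (((R : ℝ) ^ d)⁻¹ * ((R : ℝ) ^ d)⁻¹) * Real.exp (2 * δH)) (hrF : rF = rate (fun s => (d : ℝ) * (R : ℝ) ^ d * Kf s) γK cK δH)
    (hr : r = rF / 2) (hc₀ : c₀ = 2 / γK * Real.exp (2 * rF)) (hc₁ : c₁ = 2 / γK * Real.exp rF) (hΛ : Λ = h * ((R : ℝ) ^ d) ^ 2)
    (hεE : εE = (2 / γK) ^ 2 * ε * ((d : ℝ) * (R : ℝ) ^ d * Kf (rF / 2)) ^ 2) (hrU' : rU' = rate (fun s => (d : ℝ) * Kf s) (Λ + a)⁻¹ c₀ r)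
    (x x' : Tor (fine (R * N) M) × Fin d) :
    |(flucCov H' (reM (QB N R M)) - flucCov H (reM (QB N R M))) x x'| ≤
      (εE + ((2 * (Λ + a) * ((1 : ℝ) * εE * Real.exp (r * 1)) +
              4 * (Λ + a) ^ 2 * ((d : ℝ) * Kf (rU' / 2)) ^ 2 * c₁ * ((1 : ℝ) ^ 2 * εE * Real.exp (r * 2))) *
            ((d : ℝ) * Kf (min r (rU' / 2) / 2)) * (c₁ + (1 : ℝ) * εE * Real.exp (r * 1)) +
          2 * (Λ + a) * c₁ * ((d : ℝ) * Kf (min r rU' / 2)) * ((1 : ℝ) * εE * Real.exp (r * 1))) *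
        ((d : ℝ) * Kf (min r (rU' / 2) / 4))) *
        Real.exp (-(min r (rU' / 2) / 4 * (tdist (par N R M x.1) (par N R M x'.1) : ℝ))) := by
  have hγpos : 0 < γK := by rw [hγK]; exact gammaK_pos R hγ₀
  have hcK0 : 0 ≤ cK := by rw [hcK]; positivity
  have hprofF : ∀ s : ℝ, 0 < s → 0 ≤ (d : ℝ) * (R : ℝ) ^ d * Kf s := fun s hs => by have := hKf0 s hs; positivity
  have hprofU : ∀ s : ℝ, 0 < s → 0 ≤ (d : ℝ) * Kf s := fun s hs => by have := hKf0 s hs; positivity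
  have hrF0 : 0 < rF := by rw [hrF]; exact rate_pos hprofF hγpos hcK0 hδH
  have hr0 : 0 < r := by rw [hr]; positivity
  have hc₀0 : 0 ≤ c₀ := by rw [hc₀]; positivity
  have hc₁0 : 0 ≤ c₁ := by rw [hc₁]; positivity
  have hΛ0 : 0 ≤ Λ := by rw [hΛ]; positivity
  have hεE0 : 0 ≤ εE := by rw [hεE]; have := hKf0 (rF / 2) (by positivity); positivity
  have hK := coercive_reg_QB N R M hH hpsd hh hHub hγ₀ hker ha
  have hK' := coercive_reg_QB N R M hH' hpsd' hh hHub' hγ₀ hker' ha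
  rw [← hγK] at hK hK'
  have hUB := ub_QB N R M (H := H) hHub
  have hUB' := ub_QB N R M (H := H') hHub'
  simp_rw [← hΛ] at hUB hUB'
  have hP := abs_blockProp_le_QB_half N R M hKf0 hKf hH hpsd hh hHub hγ₀ hker ha hh₀ hδH hHent hγK hcK hrF hc₀
  have hP' := abs_blockProp_le_QB_half N R M hKf0 hKf hH' hpsd' hh hHub' hγ₀ hker' ha hh₀ hδH hHent' hγK hcK hrF hc₀
  have hT := abs_inv_mul_transpose_le_QB_half N R M hKf0 hKf hH hpsd hh hHub hγ₀ hker ha hh₀ hδH hHent hγK hcK hrF hc₁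
  simp_rw [← hr] at hP hP' hT
  have hE := abs_inv_sub_inv_regForm_le N R M hKf0 hKf hH hpsd hH' hpsd' hh hHub hHub' hγ₀ hker hker' ha hh₀ hδH hHent hHent' hε hdiff hγK hcK hrF
  simp_rw [← hεE, ← hr] at hE
  have h := abs_avg_flucCov_sub_le_of_soft (Qf := (1 : Matrix (Tor (fine (R * N) M) × Fin d) (Tor (fine (R * N) M) × Fin d) ℝ))
    (ρ := fun b b' : Tor (fine N M) × Fin d => (tdist b.1 b'.1 : ℝ))
    (D := fun x x' : Tor (fine (R * N) M) × Fin d => (tdist (par N R M x.1) (par N R M x'.1) : ℝ))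
    (σ := fun (x : Tor (fine (R * N) M) × Fin d) (b : Tor (fine N M) × Fin d) => (tdist (par N R M x.1) b.1 : ℝ))
    (Kσ := fun s => (d : ℝ) * Kf s)
    hprofU (isPseudoDist_coarse N M) (sumBound_coarse N M hKf) ha hγpos hΛ0 hc₀0 hr0 hεE0 le_rfl hc₁0 hr0 le_rfl hH hpsd hK hUB hP hH' hpsd'
    (by simpa only [Matrix.mul_one] using hK') (by simpa only [Matrix.mul_one] using hUB') (by simpa only [Matrix.mul_one] using hP')
    (by simpa only [Matrix.mul_one, Matrix.one_mul, Matrix.transpose_one] using hE)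
    zero_le_one (fun b => (sum_abs_reM_QB_row N R M b).le) (fun b x b' x' hb hb' => tdist_le_tdist_par_add_two N R M hb hb')
    (fun b x x' hb' => tdist_par_le_tdist_par_add_one N R M x hb')
    (fun x b => Nat.cast_nonneg _) (fun x b b' => by exact_mod_cast tdist_triangle (par N R M x.1) b'.1 b.1) hT
    (fun x x' => Nat.cast_nonneg _)
    (fun x x' b => by
      have h1 := tdist_triangle (par N R M x.1) b.1 (par N R M x'.1)
      rw [tdist_comm b.1] at h1
      exact_mod_cast h1)
    (fun s hs x => sum_exp_sigma_le N R M hKf hs x) x x'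
  rw [← hrU'] at h
  simpa only [Matrix.mul_one, Matrix.one_mul, Matrix.transpose_one] using h

end Ends

end Summit.QuantumFields.BalabanUV.Beta.GAN24.OneStepConstraintRate

end
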